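import Mathlib
import Summits.Ventures.PercRepro2.LocRows
import Summits.Ventures.PercRepro2.SwRow
import Summits.Ventures.PercRepro2.SwOut
import Summits.Ventures.PercRepro2.SwAllRow
import Summits.Ventures.PercRepro2.SwOutAll
import Summits.Ventures.PercRepro2.SwOutArmFlip
import Summits.Ventures.PercRepro2.SwOutArmThm
import Summits.Ventures.PercRepro2.SwOutCoreDefs
import Summits.Ventures.PercRepro2.SwOutCoreHull
import Summits.Ventures.PercRepro2.SwOutCoreDual
import Summits.Ventures.PercRepro2.SwOutCoreKey
import Summits.Ventures.PercRepro2.SwOutShadowDefs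
import Summits.Ventures.PercRepro2.SwOutShadowCube
import Summits.Ventures.PercRepro2.SwOutCoreShadowDefs
import Summits.Ventures.PercRepro2.SwOutCoreShadowFlip
import Summits.Ventures.PercRepro2.SwOutJunctionH1Defs
import Summits.Ventures.PercRepro2.SwOutJunctionH1Arms
import Summits.Ventures.PercRepro2.SwOutCoreToggle
import Summits.Ventures.PercRepro2.SwOutCoreShadowArm
import Summits.Ventures.PercRepro2.SwOutCoreShadowKey
import Summits.Ventures.PercRepro2.SwOutCoreShadowUnion
import Summits.Ventures.PercRepro2.SwOutCoreShadowOrbit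
import Summits.Ventures.PercRepro2.SwOutEdgeDefs
import Summits.Ventures.PercRepro2.SwOutEdgeHull
import Summits.Ventures.PercRepro2.SwOutEdgeDual
import Summits.Ventures.PercRepro2.SwOutEdgeBase
import Summits.Ventures.PercRepro2.SwOutEdgeKey
import Summits.Ventures.PercRepro2.SwOutEdgeShadow
import Summits.Ventures.PercRepro2.SwOutEdgeShadowFlip
import Summits.Ventures.PercRepro2.SwOutEdgeToggle
import Summits.Ventures.PercRepro2.SwOutEdgeShadowArm
import Summits.Ventures.PercRepro2.SwOutEdgeShadowEsc
import Summits.Ventures.PercRepro2.SwOutEdgeShadowKey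
import Summits.Ventures.PercRepro2.SwOutEdgeShadowUnion

/-!
# The coarse orbits through an e-core cube and its shadow cubes (blind cell PercRepro2, night-4
g16, 2026-08-26; proofs/NIGHT4-G16.md §4)

`SwOutCoreShadowOrbit` for an e-core base (the junction `u` adjacent to `h`).  The coarse orbit
of a shadow point of a one-sided point `ω₀`, and the coarse orbit of a one-sided e-cube point —
red-one-sided (h–u edge red, u-adjacent arms as `ω₀`) or its mirror, blue-one-sided (h–u edge
BLUE, u-adjacent arms toggled) — consist of shadow points of `ω₀` and e-cube points of the base
(`mem_orbit_shadowReal`, `mem_orbit_coreRealE_oneSided`); without a dropped arm the shadow points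
are e-cube points (`shadowReal_eq_coreRealE_of_no_drop`); the canonical e-core base of a class
point of the core kind lies in the class (`coreBaseOfE_mem_outClass`).
-/

namespace Summit.Ventures.PercRepro2

namespace LocRows

open Hull

variable {V : Type*} {E : Type*} [Fintype E] [DecidableEq E]

open scoped Classical

variable {ends : E → Sym2 V}

section ToggleLemmas

variable {ι : Type*}

omit [Fintype E] [DecidableEq E] in
/-- An e-cube point with the h–u edge red is `withHuRed` of its arm coordinates. -/
lemma withHuRed_comp_some_of_none {ω : Config (Option ι)} (hn : ω none = true) :
    withHuRed (ω ∘ some) = ω := by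
  funext j
  cases j with
  | none => exact hn.symm
  | some i => rfl

omit [Fintype E] [DecidableEq E] in
/-- `toggleE` is an involution. -/
lemma toggleE_toggleE (p : ι → Prop) (ω : Config (Option ι)) : toggleE p (toggleE p ω) = ω := by
  funext j
  cases j with
  | none => simp [toggleE]
  | some i =>
    by_cases hp : p i
    · simp [toggleE, hp]
    · simp [toggleE, hp]

end ToggleLemmas

section Orbit

variable {ι : Type*} {A : ι → Set V} {pure : ι → Prop} {ζ : Config E} {h u : V} {H : Set V}
  (hb : CoreBaseE ends ζ h u H A pure) {ω₀ : Config ι}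
  (huB : ¬ uRed ends A u pure (flipAll ω₀))
include hb huB

omit [DecidableEq E] in
/-- **The coarse orbit of a shadow point**: shadow points of the same one-sided point and
e-cube points of the base. -/
theorem CoreBaseE.mem_orbit_shadowReal (hconn : ArmsConnected A ends)
    (ω' : Config (Option {i : ι // ¬ uAdjC ends u A i})) {ζ'' : Config E}
    (hζ'' : ζ'' ∈ orbit ends (allRed ends (shadowReal ends (sB ends u A ω₀) (sZ ends u A ω₀) none
      (shadowOf ends u A ω₀ ζ) ω') h) h) :
    (∃ ω'', ζ'' = shadowReal ends (sB ends u A ω₀) (sZ ends u A ω₀) none (shadowOf ends u A ω₀ ζ) ω'')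
      ∨ ∃ ω₁, ζ'' = coreRealE ends A h u ζ ω₁ := by
  have hs := hb.shadowBase' huB
  obtain ⟨p, hp⟩ := exists_armsUnion_of_mem_orbit (hs.coreFree_shadowReal ω') hζ''
  rw [flip_armsUnionE_eq hb hconn (hb.hull_shadowReal_eq huB ω')] at hp
  by_cases hpX : p (sX ends u A ω₀)
  · rw [if_pos hpX, hb.flip_sX_shadowReal ω'] at hp
    unfold farSel at hp
    exact Or.inr ⟨_, hp.trans (hb.flip_armsSel_coreRealE _ _)⟩
  · rw [if_neg hpX, ← shadowSel_far_eq, hs.flip_shadowSel_shadowReal] at hp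
    exact Or.inl ⟨_, hp⟩

omit [Fintype E] [DecidableEq E] in
/-- The hull at a blue-one-sided e-cube point (h–u edge blue, u-adjacent arms toggled): the
mirror's `sX` with the far arms. -/
theorem CoreBaseE.hull_coreRealE_oneSided_eq' {ω : Config (Option ι)} (hn : ω none = false)
    (hω : ∀ i, uAdjC ends u A i → ω (some i) = toggle (uAdjC ends u A) ω₀ i) :
    hull ends (coreRealE ends A h u ζ ω) h = {h} ∪ {x | ∃ j, x ∈ sB ends u A ω₀ j} := by
  -- the flipped point is red-one-sided for the dual base
  have hω' : ∀ i, uAdjC ends u A i → (flipAll ω ∘ some) i = ω₀ i := by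
    intro i hi
    simp only [Function.comp, flipAll, hω i hi, toggle_apply_of_pos hi, Bool.not_not]
  have hω'' : ∀ i, uAdjC ends u A i → (ω ∘ some) i = flipAll ω₀ i := by
    intro i hi
    simp only [Function.comp, flipAll, hω i hi, toggle_apply_of_pos hi]
  have huB' : ¬ uRed ends A u pure (flipAll (flipAll ω ∘ some)) := by
    rw [flipAll_comp_some, flipAll_involutive (ω ∘ some)]
    intro hu
    exact huB ((uRed_congr hω'').1 hu)
  have hn' : flipAll ω none = true := by simp [flipAll, hn]
  rw [← hull_blue, hb.blue_coreRealE, ← withHuRed_comp_some_of_none hn',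
    hb.dual.coreRealE_withHuRed, hb.dual.hull_coreReal_oneSided_eq huB', sB_congr hω']

omit [DecidableEq E] in
/-- **The coarse orbit of a one-sided e-cube point** (red-one-sided as `ω₀`, or its blue-one-sided
mirror): shadow points of `ω₀` and e-cube points of the base. -/
theorem CoreBaseE.mem_orbit_coreRealE_oneSided (hconn : ArmsConnected A ends)
    {ω : Config (Option ι)}
    (hω : (ω none = true ∧ ∀ i, uAdjC ends u A i → ω (some i) = ω₀ i) ∨
      (ω none = false ∧ ∀ i, uAdjC ends u A i → ω (some i) = toggle (uAdjC ends u A) ω₀ i))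
    {ζ'' : Config E} (hζ'' : ζ'' ∈ orbit ends (allRed ends (coreRealE ends A h u ζ ω) h) h) :
    (∃ ω'', ζ'' = shadowReal ends (sB ends u A ω₀) (sZ ends u A ω₀) none (shadowOf ends u A ω₀ ζ) ω'')
      ∨ ∃ ω₁, ζ'' = coreRealE ends A h u ζ ω₁ := by
  have hs := hb.shadowBase' huB
  -- core-freeness and the hull
  have hcf : CoreFree ends (coreRealE ends A h u ζ ω) h := by
    refine hb.coreFree_coreRealE ?_
    rintro ⟨h1, h2⟩
    rcases hω with ⟨hn, hω⟩ | ⟨hn, hω⟩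
    · rcases h2 with h2 | h2
      · simp [flipAll, hn] at h2
      · rw [flipAll_comp_some] at h2
        have hω' : ∀ i, uAdjC ends u A i → (ω ∘ some) i = ω₀ i := fun i hi => hω i hi
        exact huB ((uRed_congr (flipAll_congr hω')).1 h2)
    · rcases h1 with h1 | h1
      · rw [hn] at h1; exact absurd h1 (by decide)
      · have hω' : ∀ i, uAdjC ends u A i → (ω ∘ some) i = flipAll ω₀ i := by
          intro i hi
          simp only [Function.comp, flipAll, hω i hi, toggle_apply_of_pos hi]
        exact huB ((uRed_congr hω').1 h1)
  have hH : hull ends (coreRealE ends A h u ζ ω) h = {h} ∪ {x | ∃ j, x ∈ sB ends u A ω₀ j} := by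
    rcases hω with ⟨hn, hω⟩ | ⟨hn, hω⟩
    · have hω' : ∀ i, uAdjC ends u A i → (ω ∘ some) i = ω₀ i := fun i hi => hω i hi
      have huB' : ¬ uRed ends A u pure (flipAll (ω ∘ some)) := fun hu =>
        huB ((uRed_congr (flipAll_congr hω')).1 hu)
      rw [← withHuRed_comp_some_of_none hn, hb.coreRealE_withHuRed,
        hb.hull_coreReal_oneSided_eq huB', sB_congr hω']
    · exact hb.hull_coreRealE_oneSided_eq' huB hn hω
  obtain ⟨p, hp⟩ := exists_armsUnion_of_mem_orbit hcf hζ''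
  rw [flip_armsUnionE_eq hb hconn hH] at hp
  by_cases hpX : p (sX ends u A ω₀)
  · rw [if_pos hpX] at hp
    -- `flip sX` of the one-sided point is a shadow point
    have key : ∃ ω'', flip ends (sX ends u A ω₀) (coreRealE ends A h u ζ ω) =
        shadowReal ends (sB ends u A ω₀) (sZ ends u A ω₀) none (shadowOf ends u A ω₀ ζ) ω'' := by
      rcases hω with ⟨hn, hω⟩ | ⟨hn, hω⟩
      · refine ⟨shadowPt ends u A false (ω ∘ some), ?_⟩
        rw [← withHuRed_comp_some_of_none hn, hb.coreRealE_withHuRed]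
        exact (hb.shadowReal_eq_flip_coreReal_false (ω ∘ some) hω (shadowPt ends u A false (ω ∘ some))
          rfl (fun i => rfl)).symm
      · -- the mirror: `ω = toggleE (toggleE ω)`, and `toggleE ω` is red-one-sided
        have hω₂ : ∀ i, uAdjC ends u A i → (toggleE (uAdjC ends u A) ω ∘ some) i = ω₀ i := by
          intro i hi
          show (if uAdjC ends u A i then !ω (some i) else ω (some i)) = ω₀ i
          rw [if_pos hi, hω i hi, toggle_apply_of_pos hi, Bool.not_not]
        have hn₂ : toggleE (uAdjC ends u A) ω none = true := by
          rw [toggleE_none, hn]; rfl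
        refine ⟨shadowPt ends u A true (toggleE (uAdjC ends u A) ω ∘ some), ?_⟩
        have e1 : coreRealE ends A h u ζ ω = flip ends (sX ends u A ω₀ ∪ sZ ends u A ω₀)
            (coreReal ends A ζ (toggleE (uAdjC ends u A) ω ∘ some)) := by
          rw [← hb.coreRealE_withHuRed, withHuRed_comp_some_of_none hn₂, hb.flip_sXZ_coreRealE,
            toggleE_toggleE]
        rw [hb.shadowReal_eq_flip_coreReal_true (toggleE (uAdjC ends u A) ω ∘ some) hω₂
          (shadowPt ends u A true (toggleE (uAdjC ends u A) ω ∘ some)) rfl (fun i => rfl),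
          flip_comm (sX ends u A ω₀ ∪ sZ ends u A ω₀), ← e1]
    obtain ⟨ω'', hω''⟩ := key
    rw [hω'', ← shadowSel_far_eq, hs.flip_shadowSel_shadowReal] at hp
    exact Or.inl ⟨_, hp⟩
  · rw [if_neg hpX] at hp
    unfold farSel at hp
    exact Or.inr ⟨_, hp.trans (hb.flip_armsSel_coreRealE _ _)⟩

omit [Fintype E] [DecidableEq E] huB in
/-- **Without a dropped arm the shadow points are e-cube points.** -/
theorem CoreBaseE.shadowReal_eq_coreRealE_of_no_drop (hZ : ∀ i, uAdjC ends u A i → ω₀ i = true)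
    (ω' : Config (Option {i : ι // ¬ uAdjC ends u A i})) :
    ∃ ω₁, shadowReal ends (sB ends u A ω₀) (sZ ends u A ω₀) none (shadowOf ends u A ω₀ ζ) ω' =
      coreRealE ends A h u ζ ω₁ := by
  have hσ : shadowOf ends u A ω₀ ζ = ζ := by
    funext e
    apply shadowOf_apply_of_not
    rintro ⟨z, ⟨i, hi, hωi, _⟩, _⟩
    rw [hZ i hi] at hωi
    exact absurd hωi (by decide)
  have hζ : ζ = coreRealE ends A h u ζ (withHuRed fun _ => true) := by
    rw [hb.coreRealE_withHuRed, CoreBase.coreReal_top]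
  have e2 : flip ends (sX ends u A ω₀ ∪ sZ ends u A ω₀) ζ =
      coreRealE ends A h u ζ (toggleE (uAdjC ends u A) (withHuRed fun _ => true)) := by
    conv_lhs => rw [hζ]
    exact hb.flip_sXZ_coreRealE ω₀ _
  unfold shadowReal
  rw [hσ, shadowFalse_eq, CoreBase.farFalse_eq_armsSel]
  cases hn : ω' none with
  | false =>
    have hset : {x | false = false ∧ x ∈ sX ends u A ω₀ ∪ sZ ends u A ω₀} =
        sX ends u A ω₀ ∪ sZ ends u A ω₀ := by
      ext x; simp
    rw [hset, flip_union_of_not_both (fun e h1 h2 => by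
        rw [← CoreBase.farFalse_eq_armsSel] at h1
        exact hb.not_touches_far_sXZ ω' e h1 h2), e2, hb.flip_armsSel_coreRealE]
    exact ⟨_, rfl⟩
  | true =>
    have hset : {x | true = false ∧ x ∈ sX ends u A ω₀ ∪ sZ ends u A ω₀} = (∅ : Set V) := by
      ext x; simp
    rw [hset, Set.union_empty]
    have e3 : flip ends (armsSel A fun i => ∃ hi : ¬ uAdjC ends u A i, ω' (some ⟨i, hi⟩) = false) ζ =
        coreRealE ends A h u ζ (toggleArms
          (fun i => ∃ hi : ¬ uAdjC ends u A i, ω' (some ⟨i, hi⟩) = false)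
          (withHuRed fun _ => true)) := by
      conv_lhs => rw [hζ]
      exact hb.flip_armsSel_coreRealE _ _
    exact ⟨_, e3⟩

end Orbit

section Class

variable {U : Set V} {ξ : Config E} {h u : V}

/-- **The canonical e-core base of a class point of the core kind lies in the class** (when it is
an e-core base on the arms). -/
theorem coreBaseOfE_mem_outClass {ζ : Config E} (hcl : ζ ∈ outClass ends U h ξ)
    (hk : CoreKind ends U h u ζ) {ι : Type*} {A : ι → Set V} {pure : ι → Prop}
    (hb : CoreBaseE ends (coreBaseOfE ends ζ h u) h u (extHull ends ζ h u) A pure) :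
    coreBaseOfE ends ζ h u ∈ outClass ends U h ξ := by
  have hHU : extHull ends ζ h u ⊆ U := by
    intro x hx
    rcases hx with hx | hx
    · exact (mem_outClass.1 hcl).2 hx
    · exact hk.2 hx
  have hhU : h ∈ U := (mem_outClass.1 hcl).2 (Or.inl (mem_cluster_self _ _ _))
  rw [mem_outClass] at hcl ⊢
  refine ⟨fun e he => ?_, ?_⟩
  · have hhu : ends e ≠ s(h, u) := fun hhu => he ⟨h, hhU, u, hhu⟩
    rw [coreBaseOfE_apply_of_not_hu hhu]
    unfold coreBaseOf
    rw [flip_apply_of_notMem, hcl.1 e he]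
    intro h'
    apply he
    refine touches_mono ?_ h'
    intro x hx
    exact hHU (blueExt_subset_extHull hx)
  · have := hb.hull_coreRealE_subset (withHuRed fun _ => true)
    rw [hb.coreRealE_withHuRed, CoreBase.coreReal_top] at this
    exact this.trans hHU

end Class

end LocRows

end Summit.Ventures.PercRepro2
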